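import Summits.HubbardSuperconductivity.HubbardSuperconductivity.Theorems.BalabanIRBirComplexStableXYRVortexFluxStructure
import Summits.HubbardSuperconductivity.HubbardSuperconductivity.Theorems.BalabanIRBirComplexStableXYRStubHolonomyStrainConst
import Summits.HubbardSuperconductivity.HubbardSuperconductivity.Theorems.BalabanIRBirComplexStableXYRStubPathCfgConst
import Summits.HubbardSuperconductivity.HubbardSuperconductivity.Theorems.BalabanIRBirComplexStableXYRStubConstCochainPythagoras
import HarnessLib

/-!
# Crux `BirComplexStableXYR` (stmt-HubbardSuperconductivity-14845), line `fat-gaussian-defect-calculus`, chapter 2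
# §2.1: the flux enters every sector integrand as a CONSTANT TWIST of the window arguments

Support file (prover seat 1, route BalabanIR; item G2 — format of the `q`-sector functions `Ξ̃_q(h)`).

Combining seat 1's `stub_fixedVorticityFlux` (`σ a = σ b + σ(seam Δ)` at fixed vorticity, `Δ = wind a − wind b`) with
lead c8's E3 (`σ(seam Δ)` is the constant cochain `(2πΔ_i/N_i)_i`) and E2 (window configuration of a constant cochain),
the complete `h`-dependence of a sector term of R9/R10 at fixed vorticity `q` is a constant twist:

* **`stub_fluxTwistStructure`** (registered stub): for ANY strain map with the two properties of
  `stub_fsRepresentation`, for all tree-gauge cochains `a, b` with `d₁ a = d₁ b`, writing `Δ = wind a − wind b`: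
  (1) `σ a = σ b + κ_Δ`, `κ_Δ(x,i) = 2πΔ_i/N_i` (constant);
  (2) for every real cochain `ω`, corner `s` and window site `w`:
  `P(ω − σ a) s w = P(ω − σ b) s w − 2π(Δ₀w₁/L + Δ₁w₂/L + Δ₂w₃/M)`.
  So every local factor `R_s(P_s(d₀ψ − σ_a))` of the `(q,h)` sector is the `(q,h₀)` factor with ALL window arguments
  shifted by the same linear configuration `v̄_Δ` — the sector functions `Ξ̃_q(h)` are values of one smooth function of a
  continuous twist `ϑ = 2πΔ/N ∈ ℝ³`, which is the structural input of the Poisson/charge representation of the `h`-series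
  beyond the Gaussian level (line card §2.1 CAUTION; seat 0's format notes F1′–F3′).

No definitions; sorry-free. [folklore: twisted boundary conditions / torons]
-/

noncomputable section

namespace Summit.HubbardSuperconductivity.HubbardSuperconductivity.Theorems

set_option linter.dupNamespace false -- summit = problem name (single-conjunct summit), D-0017

open scoped BigOperators ComplexConjugate
open Complex Summit.HubbardSuperconductivity.BirComplexStableXYNegative
open Literature.Probability.LatticeModels Literature.MathematicalPhysics.QuantumFieldTheory

section FluxTwistStructure

variable {r : ℕ} {L M : ℕ} [NeZero L] [NeZero M]

/-- The staircase path map is additive in the cochain (each `lineSum` is). [folklore] -/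
theorem fts_pathCfg_sub (P : (Λ L M → Fin 3 → ℝ) → Λ L M → W r → ℝ)
    (hP : ∀ (ω : Λ L M → Fin 3 → ℝ) (s : Λ L M) (w : W r), P ω s w =
      (TorusChart.piProdZMod 2 L M).lineSum ω 0 (w.1 : ℕ) s
        + (TorusChart.piProdZMod 2 L M).lineSum ω 1 (w.2.1 : ℕ) (s + (w.1 : ℕ) • (TorusChart.piProdZMod 2 L M).gen 0)
        + (TorusChart.piProdZMod 2 L M).lineSum ω 2 (w.2.2 : ℕ)
          (s + (w.1 : ℕ) • (TorusChart.piProdZMod 2 L M).gen 0 + (w.2.1 : ℕ) • (TorusChart.piProdZMod 2 L M).gen 1))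
    (ω η : Λ L M → Fin 3 → ℝ) (s : Λ L M) (w : W r) :
    P (ω - η) s w = P ω s w - P η s w := by
  rw [hP, hP, hP, TorusChart.lineSum_sub, TorusChart.lineSum_sub, TorusChart.lineSum_sub]
  ring

/-- **Registered stub `stub_fluxTwistStructure` (prover seat 1 on stmt-HubbardSuperconductivity-14845; chapter 2 §2.1,
with lead c8's E1–E3): the flux enters every sector integrand as a constant twist.**  For a table with `Σ c_n = 0`,
coercivity (C), `r ≥ 2`, and ANY strain map `σ` with the two properties of `stub_fsRepresentation`: for all tree-gauge
cochains `a, b` with the same vorticity, `Δ = wind a − wind b`, (1) `σ a = σ b + (2πΔ_i/N_i)_i` and (2)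
`P(ω − σ a) s w = P(ω − σ b) s w − 2π(Δ₀w₁/L + Δ₁w₂/L + Δ₂w₃/M)` for every `ω, s, w`. [folklore] -/
theorem stub_fluxTwistStructure : ∀ (r : ℕ) (c : Table r) (c₀ : ℝ), 2 ≤ r → 0 < c₀ → c.sum (fun _ a => a) = 0 → (∀ φ : W r → ℝ, c₀ * ∑ w, ∑ w', (1 - Real.cos (φ w - φ w')) ≤ (genF c φ).re) → ∀ (L M : ℕ) [NeZero L] [NeZero M] (P : (Λ L M → Fin 3 → ℝ) → Λ L M → W r → ℝ), (∀ (ω : Λ L M → Fin 3 → ℝ) (s : Λ L M) (w : W r), P ω s w = (TorusChart.piProdZMod 2 L M).lineSum ω 0 (w.1 : ℕ) s + (TorusChart.piProdZMod 2 L M).lineSum ω 1 (w.2.1 : ℕ) (s + (w.1 : ℕ) • (TorusChart.piProdZMod 2 L M).gen 0) + (TorusChart.piProdZMod 2 L M).lineSum ω 2 (w.2.2 : ℕ) (s + (w.1 : ℕ) • (TorusChart.piProdZMod 2 L M).gen 0 + (w.2.1 : ℕ) • (TorusChart.piProdZMod 2 L M).gen 1)) → ∀ (Q : (W r → ℝ)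 → ℝ), (∀ u : W r → ℝ, Q u = (-c.sum (fun n a => a * (((∑ w, (n w : ℝ) * u w) ^ 2 : ℝ) : ℂ))).re) → ∀ (σ : {a : Λ L M → Fin 3 → ℤ // ∀ (y : Λ L M) (μ : Fin 3), (∀ ν : Fin 3, μ < ν → (TorusChart.piProdZMod 2 L M).cval ν y = 0) → (TorusChart.piProdZMod 2 L M).cval μ y + 1 < (TorusChart.piProdZMod 2 L M).period μ → a y μ = 0} → (Λ L M → Fin 3 → ℝ)), (∀ a, ∃ ψ : Λ L M → ℝ, σ a = fun x i => 2 * Real.pi * (a.1 x i : ℝ) - (TorusChart.piProdZMod 2 L M).d₀ ψ x i) → (∀ a (u : Λ L M → ℝ), ∑ s : Λ L M, Q (P (fun x i => (TorusChart.piProdZMod 2 L M).d₀ u x i - σ a x i) s) = ∑ s : Λ L M, Q (P ((TorusChart.piProdZMod 2 L M).d₀ u) s) + ∑ s : Λ L M, Q (P (σ a) s)) → ∀ (a b : {a : Λ L M → Fin 3 → ℤ // ∀ (y : Λ L M) (μ : Fin 3), (∀ ν : Fin 3, μ < ν → (TorusChart.piProdZMod 2 L M).cval ν y = 0) → (TorusChart.piProdZMod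 2 L M).cval μ y + 1 < (TorusChart.piProdZMod 2 L M).period μ → a y μ = 0}), (TorusChart.piProdZMod 2 L M).d₁ a.1 = (TorusChart.piProdZMod 2 L M).d₁ b.1 → (σ a = fun x i => σ b x i + 2 * Real.pi * (((TorusChart.piProdZMod 2 L M).wind a.1 - (TorusChart.piProdZMod 2 L M).wind b.1) i : ℝ) / ((TorusChart.piProdZMod 2 L M).period i : ℝ)) ∧ (∀ (ω : Λ L M → Fin 3 → ℝ) (s : Λ L M) (w : W r), P (fun x i => ω x i - σ a x i) s w = P (fun x i => ω x i - σ b x i) s w - 2 * Real.pi * ((((TorusChart.piProdZMod 2 L M).wind a.1 - (TorusChart.piProdZMod 2 L M).wind b.1) 0 : ℝ) * ((w.1 : ℕ) : ℝ) / L + (((TorusChart.piProdZMod 2 L M).wind a.1 - (TorusChart.piProdZMod 2 L M).wind b.1) 1 : ℝ) * ((w.2.1 : ℕ) : ℝ) / L + (((TorusChart.piProdZMod 2 L M).wind a.1 - (TorusChart.piProdZMod 2 L M).wind b.1) 2 : ℝ) * ((w.2.2 : ℕ) : ℝ) / M)) := by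
  intro r c c₀ hr hc₀ hA hC L M _ _ P hP Q hQ σ hcls hpy a b hd
  have hper0 : (TorusChart.piProdZMod 2 L M).period 0 = L := TorusChart.piProdZMod_period_castSucc 2 L M 0
  have hper1 : (TorusChart.piProdZMod 2 L M).period 1 = L := TorusChart.piProdZMod_period_castSucc 2 L M 1
  have hper2 : (TorusChart.piProdZMod 2 L M).period 2 = M := TorusChart.piProdZMod_period_last 2 L M
  set Δ : Fin 3 → ℤ := (TorusChart.piProdZMod 2 L M).wind a.1 - (TorusChart.piProdZMod 2 L M).wind b.1 with hΔ
  -- fixed vorticity: `σ a = σ b + σ(seam Δ)` (seat 1)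
  obtain ⟨S, _, _, hfix⟩ := stub_fixedVorticityFlux r c c₀ hr hc₀ hA hC L M P hP Q hQ σ hcls hpy
  obtain ⟨ℓ, hℓ⟩ := hfix b
  obtain ⟨hdec, _⟩ := hℓ a hd
  -- E1 + E3: the strain of a seam is the constant twist (lead c8)
  have hE1 := FSUnfolding.stub_constCochainPythagoras r c L M P hP Q hQ
  have hconst : σ ⟨(TorusChart.piProdZMod 2 L M).seam Δ, fun y μ _ hμ => (TorusChart.piProdZMod 2 L M).seam_of_lt _ y μ hμ⟩
      = fun _ i => 2 * Real.pi * (Δ i : ℝ) / ((TorusChart.piProdZMod 2 L M).period i : ℝ) :=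
    FSUnfolding.stub_holonomyStrainConst r c c₀ hr hc₀ hA hC L M P hP Q hQ hE1 Δ
      ((TorusChart.piProdZMod 2 L M).seam Δ) ((TorusChart.piProdZMod 2 L M).d₁_seam Δ)
      ((TorusChart.piProdZMod 2 L M).wind_seam Δ) _ (hcls _) (hpy _)
  have h1 : σ a = fun x i => σ b x i + 2 * Real.pi * (Δ i : ℝ) / ((TorusChart.piProdZMod 2 L M).period i : ℝ) := by
    rw [hdec, hconst]
    funext x i
    simp only [Pi.add_apply]
  refine ⟨h1, fun ω s w => ?_⟩
  -- (2): `ω − σ a = (ω − σ b) − κ_Δ` and `P` is additive; E2 evaluates `P κ_Δ`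
  have hsplit : (fun x i => ω x i - σ a x i)
      = (fun x i => ω x i - σ b x i) - (fun (_ : Λ L M) (i : Fin 3) => 2 * Real.pi * (Δ i : ℝ) / ((TorusChart.piProdZMod 2 L M).period i : ℝ)) := by
    funext x i
    simp only [h1, Pi.sub_apply]
    ring
  rw [hsplit, fts_pathCfg_sub P hP, FSUnfolding.stub_pathCfg_const r L M P hP
    (fun i => 2 * Real.pi * (Δ i : ℝ) / ((TorusChart.piProdZMod 2 L M).period i : ℝ)) s w, hper0, hper1, hper2]
  simp only [hΔ, Pi.sub_apply, Int.cast_sub]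
  ring

end FluxTwistStructure

end Summit.HubbardSuperconductivity.HubbardSuperconductivity.Theorems

end
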